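import Summits.QuantumFields.YangMills.Theorems.AlphaInputsT3ACv3StepLowMaxB3
import Summits.QuantumFields.YangMills.Theorems.AlphaInputsT3ACChargeOfDeepFibrePoint
import Summits.QuantumFields.YangMills.Theorems.AlphaInputsT3ACDeepFibrePointOfRows
import HarnessLib

/-!
# `AlphaInputsT3ACv3StepLowMaxB3OfDeepPoints` — THE (E1) LOWER ROW AT THE ROWS RECORD WITH THE CHARGING LETTER DISCHARGED (cell `ym3-torus`, ★★OWNER g35∕g36 RECORDs 17cm∕17co (b): (α)-row #23
# `fibre57LowOn`; seat `ym-ust-19936-w8` g16, TWIN-WIDTH helper; `--supports stmt-QuantumFields-19936 --as helper`; file C = the E2E knit of px20 g13's ✓p775182 (E1) edition, ✓p775687 (L1) letter and this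
# seat's ✓file B `…ChargeOfDeepFibrePoint`)

WHAT.  One `exact`, no new estimate: ✓`AlphaInputsT3AC.PkgCoreRows.fibre57LowOnAC_T3_maxB₃_of_hcharge` (px20 g13, ✓p775182: the lower step row R3D-02χ [Balaban1985UV3] (47)∕(57) at the T³ record on the
constant-`max B₃ 1` family, every rows-record letter discharged) with its LAST displayed letter `hcharge` («the window-restricted push-forward of Haar charges the family») DISCHARGED by
✓`PinnedStepTrivPins.hcharge_of_deepFibrePoints` (file B: the N09 local route — local submersion of (0.4) + positive local density + Lindelöf) fed with ✓`AlphaInputsT3AC.PkgCoreRows.hdeep_of_rows`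
(✓p775687: the χ^min deep fibre point `(blockAvg ℰp)^k U_{k+1}(V)` by the sharp symmetric Prop. 2) at `c := max B₃ 1`.  ★★★ `fibre57LowOnAC_T3_maxB₃_of_deepPointRows`: the (E1) lower row holds MODULO
EXACTLY the chart binders `(Φ, J, T, hΦ, hJ, hT, hmap, hfib)` (✓inhabited), the Gaussian datum `(N, lσ, dg, q_1, hqm, hZ)`, the gauge invariance `hinv` (B0), the (55)∕(58) PINS `hσ hdg hstar hZU hFl`
(B0 DEFINER), and the THREE γ-SIZE ROWS of (L1) at `α₀ := max(B₃,1)·ε₁(k+1)·L⁻²`: `hP3` (`143·((d+4)²∕4)²·α₀ ≤ ⅓`), `hP2` (`2α₀ ≤ 2δ_{SU(2)}∕((d+4)L)²`), `hwin` (`2α₀ < ε₁(k)` — the (E1) floor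
`2·max(B₃,1) < L^{3∕2}` in threshold currency).  After this file RECORD 17cm's #23 residue is {B0 pins, `hinv`, charts, Gaussian datum, three size rows}: NO measure-theoretic letter is left.

HONEST SCOPE.  [folklore] composition; def-free; nothing of [Balaban1985UV3] (37)∕(47)∕(57) on print's `loPrintAC`, of row #23's pins, of the (α) data rows (0∕23), of (O‴χₛ), `HistoryTailL` (19936),
EX, LOWB∘ or `YM3TorusSU2` is proved (rung R3 = SU(2) YM₃ on T³, a RECORD rung: NOT d = 4, NOT infinite volume, NOT a mass gap, NOT Clay; the Yang–Mills mass gap is NOT proved).  L-floor: inside `hwin`.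
References: T. Bałaban, Commun. Math. Phys. **102** (1985) 255–275 [Balaban1985UV3] ((37) p.265, (47) p.267, (49)–(58) pp.268–270, p.272 L32–33); Commun. Math. Phys. **98** (1985) 17–51
[Balaban1985Averaging] (Prop. 2 (52)–(54) p.26).
-/

set_option autoImplicit false

noncomputable section

namespace Summit.QuantumFields.YangMills.Theorems

open MeasureTheory Literature.MathematicalPhysics.QuantumFieldTheory.Balaban1983to89
open Literature.MathematicalPhysics.QuantumFieldTheory.Balaban1983to89.GaugeField (GaugeInvariant gaugeAct)
open Literature.MathematicalPhysics.QuantumFieldTheory.Balaban1983to89.BlockAveraging (avgFun loopHol Idx)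
open Literature.MathematicalPhysics.QuantumFieldTheory.Balaban1983to89.ExpMeanLog (expMeanLogSU deltaSU)
open Literature.MathematicalPhysics.QuantumFieldTheory.Balaban1983to89.T3ContinuumYM3Torus
open Literature.MathematicalPhysics.QuantumFieldTheory.Balaban1983to89.T3UnitScaleTilt (θBal)
open Literature.MathematicalPhysics.QuantumFieldTheory.Balaban1985CMP102 Literature.MathematicalPhysics.QuantumFieldTheory.Balaban1985CMP102.Setting
open Summit.QuantumFields.Balaban3D.Carriers
open Summit.QuantumFields.Balaban3D.Proofs.Primitives
open Summit.QuantumFields.Balaban3D.Proofs.TowerAC Summit.QuantumFields.Balaban3D.Proofs.StandardAC Summit.QuantumFields.Balaban3D.Proofs.InputsAC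
open Summit.QuantumFields.Balaban3D.Proofs.Bound55Masses (chiB)
open Summit.QuantumFields.Balaban3D.Proofs.GaussianNormalization (partZ normalized)
open Summit.QuantumFields.Balaban3D.Proofs.Thresholds (Q0)
open Summit.QuantumFields.YangMills.Theorems.PinnedStep (Fibre57LowOnAC)
open scoped NNReal ENNReal

variable {F : T3Family} {𝔠 : AlphaConsts F.L (suGroupModel 2).N} {γ : ℝ} {hγ : 0 < γ} {hγ1 : γ ≤ (min 𝔠.gamma0 1) ^ 2} {K : ℕ}

namespace AlphaInputsT3AC.PkgCoreRows

variable (q : AlphaInputsT3AC.PkgCoreRows F 𝔠 γ hγ hγ1 K)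

/-- ★★★ **THE (E1) LOWER ROW AT THE ROWS RECORD, CHARGING LETTER DISCHARGED** — ✓`fibre57LowOnAC_T3_maxB₃_of_hcharge` (✓p775182) VERBATIM except that the last letter `hcharge` is REPLACED by the three
γ-size rows `hP3 hP2 hwin` of the deep-fibre-point letter at `α₀ := max(B₃,1)·ε₁(k+1)·L⁻²`; proof = that theorem fed with ✓`PinnedStepTrivPins.hcharge_of_deepFibrePoints ∘ hdeep_of_rows` at
`c := max B₃ 1`.  Displayed residue: charts (inhabited), Gaussian datum, `hinv` (B0), (55)∕(58) pins (B0 DEFINER), `hP3 hP2 hwin` (γ∕L arithmetic).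
[cite: Balaban1985UV3, (37) p.265 + (47) p.267 + (49)–(58) pp.268–270 + p.272 L32–33] [cite: Balaban1985Averaging, Prop. 2 (52)–(54) p.26] -/
theorem fibre57LowOnAC_T3_maxB₃_of_deepPointRows (ha₁ : ∀ i, θBal F.L γ 𝔠.b₀ 𝔠.p₀ i ≤ q.a₁)
    (hγs : γ ≤ ((((4500 : ℝ) * (F.L : ℝ) ^ 5)⁻¹ / (𝔠.b₀ * Q0 𝔠.p₀)) ^ 2) ^ 2)
    (k : ℕ) (hk : k + 1 ≤ K)
    (hP3 : (143 * (((((F.P K).d + 4 : ℕ) : ℝ)) ^ 2 / 4) ^ 2) *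
      (max 𝔠.B₃ 1 * eps1Of (T3Scales F γ hγ (hγ1.trans (sq_min_one_le _ 𝔠.gamma0_pos)) K) 𝔠.lane.carrier (k + 1) * ((F.L : ℝ)⁻¹) ^ 2) ≤ 1 / 3)
    (hP2 : 2 * (max 𝔠.B₃ 1 * eps1Of (T3Scales F γ hγ (hγ1.trans (sq_min_one_le _ 𝔠.gamma0_pos)) K) 𝔠.lane.carrier (k + 1) * ((F.L : ℝ)⁻¹) ^ 2) ≤
      2 * deltaSU (Fin 2) / ((((F.P K).d + 4) * (F.P K).L : ℕ) : ℝ) ^ 2)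
    (hwin : 2 * (max 𝔠.B₃ 1 * eps1Of (T3Scales F γ hγ (hγ1.trans (sq_min_one_le _ 𝔠.gamma0_pos)) K) 𝔠.lane.carrier (k + 1) * ((F.L : ℝ)⁻¹) ^ 2) <
      eps1Of (T3Scales F γ hγ (hγ1.trans (sq_min_one_le _ 𝔠.gamma0_pos)) K) 𝔠.lane.carrier k)
    (Φ : GaugeField (F.P K) (k + 1) (Matrix.specialUnitaryGroup (Fin 2) ℂ) × GaugeField (F.P K) k (Matrix.specialUnitaryGroup (Fin 2) ℂ) →
      GaugeField (F.P K) k (Matrix.specialUnitaryGroup (Fin 2) ℂ))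
    (J : GaugeField (F.P K) (k + 1) (Matrix.specialUnitaryGroup (Fin 2) ℂ) × GaugeField (F.P K) k (Matrix.specialUnitaryGroup (Fin 2) ℂ) → ℝ≥0)
    (T : Set (GaugeField (F.P K) (k + 1) (Matrix.specialUnitaryGroup (Fin 2) ℂ) × GaugeField (F.P K) k (Matrix.specialUnitaryGroup (Fin 2) ℂ)))
    (hΦ : Measurable Φ) (hJ : Measurable J) (hT : MeasurableSet T)
    (hmap : ((((fieldMeasure (F.P K) (k + 1) (Matrix.specialUnitaryGroup (Fin 2) ℂ)).prod
        (fieldMeasure (F.P K) k (Matrix.specialUnitaryGroup (Fin 2) ℂ))).restrict T).withDensity (fun z => (J z : ℝ≥0∞))).map Φ =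
      (fieldMeasure (F.P K) k (Matrix.specialUnitaryGroup (Fin 2) ℂ)).restrict
        {U : GaugeField (F.P K) k (Matrix.specialUnitaryGroup (Fin 2) ℂ) |
          ∀ c i, dist1 (loopHol U c i) < ((Fintype.card (Idx (F.P K)) : ℝ))⁻¹ / 10})
    (hfib : ∀ z ∈ T, avgFun (expMeanLogSU (n := Fin 2)) (Φ z) = z.1) (N lσ dg : ℝ)
    (q_1 : GaugeField (F.P K) (k + 1) (Matrix.specialUnitaryGroup (Fin 2) ℂ) → GaugeField (F.P K) k (Matrix.specialUnitaryGroup (Fin 2) ℂ) → ℝ)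
    (hqm : ∀ V, Measurable (q_1 V)) (hZ : ∀ V, 0 < partZ (fieldMeasure (F.P K) k (Matrix.specialUnitaryGroup (Fin 2) ℂ)) (q_1 V))
    (hinv : GaugeInvariant (fun U : GaugeField (F.P K) k (Matrix.specialUnitaryGroup (Fin 2) ℂ) =>
      Real.exp (-((towerOfAC 𝔠.lane q.X q.𝔖).mainT k (Hist.triv (F.P K) k) U) + (towerOfAC 𝔠.lane q.X q.𝔖).Pint k (Hist.triv (F.P K) k) U)))
    (hσ : (piecesAC 𝔠.lane q.X q.𝔖 k).logσ₀ = lσ) (hdg : (piecesAC 𝔠.lane q.X q.𝔖 k).dg = dg)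
    (hstar : (piecesAC 𝔠.lane q.X q.𝔖 k).starB (Hist.triv (F.P K) (k + 1)) = N)
    (hZU : ∀ V, (piecesAC 𝔠.lane q.X q.𝔖 k).logZU (Hist.triv (F.P K) (k + 1)) V =
      Real.log (partZ (fieldMeasure (F.P K) k (Matrix.specialUnitaryGroup (Fin 2) ℂ)) (q_1 V)))
    (hFl : ∀ V, (piecesAC 𝔠.lane q.X q.𝔖 k).logFl (Hist.triv (F.P K) (k + 1)) V =
      Real.log (∫ U', (Real.exp (-((lσ + dg * Real.log ((T3Scales F γ hγ (hγ1.trans (sq_min_one_le _ 𝔠.gamma0_pos)) K).gk k)) * N)) * T.indicator (fun z => (J z : ℝ)) (V, U')) *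
              chiB 𝔠.lane.carrier.M₁ (rcolOf (T3Scales F γ hγ (hγ1.trans (sq_min_one_le _ 𝔠.gamma0_pos)) K) 𝔠.lane.carrier) (eps1Of (T3Scales F γ hγ (hγ1.trans (sq_min_one_le _ 𝔠.gamma0_pos)) K) 𝔠.lane.carrier) k
                (Hist.triv (F.P K) (k + 1)) (Φ (V, U')) *
              Real.exp (-((towerOfAC 𝔠.lane q.X q.𝔖).mainT k (Hist.triv (F.P K) k) (Φ (V, U')) -
                    (towerOfAC 𝔠.lane q.X q.𝔖).mainT (k + 1) (Hist.triv (F.P K) (k + 1)) V)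
                + ((towerOfAC 𝔠.lane q.X q.𝔖).Pint k (Hist.triv (F.P K) k) (Φ (V, U')) - (piecesAC 𝔠.lane q.X q.𝔖 k).Pold (Hist.triv (F.P K) (k + 1)) V)
                + q_1 V U')
            ∂(normalized (fieldMeasure (F.P K) k (Matrix.specialUnitaryGroup (Fin 2) ℂ)) (q_1 V)))) :
    Fibre57LowOnAC 𝔠.lane q.X q.𝔖
      (fun j => {V : GaugeField (F.P K) j (Matrix.specialUnitaryGroup (Fin 2) ℂ) |
          PlaqSmall (eps1Of (T3Scales F γ hγ (hγ1.trans (sq_min_one_le _ 𝔠.gamma0_pos)) K) 𝔠.lane.carrier j) V} ∩ PinnedStep.chiMinAC 𝔠.lane q.X (max 𝔠.B₃ 1) j) k :=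
  q.fibre57LowOnAC_T3_maxB₃_of_hcharge ha₁ hγs k hk Φ J T hΦ hJ hT hmap hfib N lσ dg q_1 hqm hZ hinv hσ hdg hstar hZU hFl
    (PinnedStepTrivPins.hcharge_of_deepFibrePoints 𝔠 hγs
      (fun j => {V : GaugeField (F.P K) j (Matrix.specialUnitaryGroup (Fin 2) ℂ) |
          PlaqSmall (eps1Of (T3Scales F γ hγ (hγ1.trans (sq_min_one_le _ 𝔠.gamma0_pos)) K) 𝔠.lane.carrier j) V} ∩ PinnedStep.chiMinAC 𝔠.lane q.X (max 𝔠.B₃ 1) j)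
      k (by omega) (q.hdeep_of_rows k hk (lt_max_of_lt_right one_pos) hP3 hP2 hwin))

end AlphaInputsT3AC.PkgCoreRows

end Summit.QuantumFields.YangMills.Theorems

end
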